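import Mathlib
import Summits.KontsevichZagierPeriods.KontsevichZagierPeriods.Theorems.SoloInformedDefMoveDomainAddI
import Summits.KontsevichZagierPeriods.KontsevichZagierPeriods.Theorems.SoloInformedDefMoveNewtonLeibniz
import HarnessLib

/-!
# Solo-informed (A390-ii): generator definability for ARBITRARY chains, III — the
Newton–Leibniz move (3)

File F6i.  Conditional on the Lion–Rolin preparation fact, every (unbounded) Newton–Leibniz move
`[r] − [r'] ∈ KZOver.newtonLeibnizRel ℝ` satisfies the definability invariant
`SoloInformedDefinableRelI` (`soloInformed_definableRelI_newtonLeibnizRel`).  The clauses are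
those of `SoloInformedDefMoveNewtonLeibniz` (order, band, Newton–Leibniz, continuity,
derivative — all first order); admissibility of `r, r'` is I-admissibility (KERNEL LEMMA I).

References: [cite: KontsevichZagier2001, §1.2 rule (3)]; [cite: BochnakCosteRoy1998, Prop. 2.2.4];
[cite: ComteLionRolin2000, Thm. 3].
-/

noncomputable section

open Set MeasureTheory Literature.ModelTheory.ExponentialFields
  Literature.NumberTheory.Transcendental

namespace Summit.KontsevichZagierPeriods.KontsevichZagierPeriods.Theorems

namespace SoloInformedPCombo

variable {K : Type} {m m' : ℕ}

/-- The element I-denoted by the two-term combination. [cite: KontsevichZagier2001, §1.2] -/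
theorem comboI_twoTerm (T : SoloInformedPTerm K m) (T' : SoloInformedPTerm K m') (p : K → ℝ) :
    (twoTerm T T').comboI p = KZOver.of (T.repI p) - KZOver.of (T'.repI p) := by
  show ∑ b : Bool, (twoTerm T T').coef b • KZOver.of (((twoTerm T T').term b).repI p) = _
  rw [Fintype.sum_bool]
  show (1 : ℤ) • KZOver.of (T.repI p) + (-1 : ℤ) • KZOver.of (T'.repI p) = _
  rw [one_zsmul, neg_one_zsmul, sub_eq_add_neg]

/-- I-admissibility of the two-term combination. [cite: KontsevichZagier2001, §1.1] -/
theorem admI_twoTerm {T : SoloInformedPTerm K m} {T' : SoloInformedPTerm K m'} {p : K → ℝ}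
    (hT : T.SoloInformedAdmI p) (hT' : T'.SoloInformedAdmI p) :
    (twoTerm T T').SoloInformedAdmI p := by
  intro b
  cases b
  · exact hT'
  · exact hT

/-- A rational lift of the two-term combination from rational forms of its terms.
[cite: KontsevichZagier2001, §1.2] -/
theorem ratLiftI_twoTerm {T : SoloInformedPTerm K m} {T' : SoloInformedPTerm K m'} {p : K → ℝ}
    (q : KZOver.IntegralRep ℚ m) (q' : KZOver.IntegralRep ℚ m') (h : q.baseChange ℝ = T.repI p)
    (h' : q'.baseChange ℝ = T'.repI p) (hrel : KZOver.of q - KZOver.of q' ∈ KZOver.relations ℚ) :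
    (twoTerm T T').SoloInformedRatLiftI p := by
  let L : (b : Bool) → KZOver.IntegralRep ℚ (cond b m m') := fun b => match b with
    | true => q
    | false => q'
  refine ⟨L, fun b => ?_, ?_⟩
  · cases b
    · exact h'
    · exact h
  · show ∑ b : Bool, cond b (1 : ℤ) (-1) • KZOver.of (L b) ∈ KZOver.relations ℚ
    rw [Fintype.sum_bool]
    show (1 : ℤ) • KZOver.of q + (-1 : ℤ) • KZOver.of q' ∈ _
    rwa [one_zsmul, neg_one_zsmul, ← sub_eq_add_neg]

end SoloInformedPCombo

namespace SoloInformedPTerm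

variable {K : Type} {d : ℕ} {p : K → ℝ}

/-- **The clauses give the side conditions of move (3)** for the I-denoted representations, with
the hybrid functions of `W, A, B` as `F, a, b`. [cite: KontsevichZagier2001, §1.2 rule (3)] -/
theorem nl_sideI {T W : SoloInformedPTerm K (d + 1)} {T' A B : SoloInformedPTerm K d}
    (hT : T.SoloInformedAdmI p) (hT' : T'.SoloInformedAdmI p) (hW : W.SoloInformedFunctional p)
    (hA : A.SoloInformedFunctional p) (hB : B.SoloInformedFunctional p)
    (hWT : W.fibre p = T.fibre p) (hAT : A.fibre p = T'.fibre p) (hBT : B.fibre p = T'.fibre p)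
    (hle : SoloInformedLeClause A B p) (hd₁ : SoloInformedDomClause₁ T A B p)
    (hd₂ : SoloInformedDomClause₂ T A B p) (hnl : SoloInformedNLClause T' W A B p)
    (hco : SoloInformedContClause W A B p) (hde : SoloInformedDerivClause T W A B p) :
    (∀ x ∈ (T'.repI p).domain, A.hybrid p x ≤ B.hybrid p x) ∧
    (T.repI p).domain = {z | (Fin.init z : Fin d → ℝ) ∈ (T'.repI p).domain ∧
      A.hybrid p (Fin.init z) ≤ z (Fin.last d) ∧ z (Fin.last d) ≤ B.hybrid p (Fin.init z)} ∧
    (∀ x ∈ (T'.repI p).domain, ContinuousOn (fun t : ℝ => W.hybrid p (Fin.snoc x t))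
      (Icc (A.hybrid p x) (B.hybrid p x))) ∧
    (∀ x ∈ (T'.repI p).domain, ∀ t ∈ Ioo (A.hybrid p x) (B.hybrid p x),
      HasDerivAt (fun s : ℝ => W.hybrid p (Fin.snoc x s))
        ((T.repI p).integrand (Fin.snoc x t)) t) ∧
    (∀ x ∈ (T'.repI p).domain, (T'.repI p).integrand x =
      W.hybrid p (Fin.snoc x (B.hybrid p x)) - W.hybrid p (Fin.snoc x (A.hybrid p x))) ∧
    W.fibre p = (T.repI p).domain ∧ A.fibre p = (T'.repI p).domain ∧
      B.fibre p = (T'.repI p).domain := by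
  rw [repI_domain hT, repI_domain hT', ← hAT]
  have hgA : ∀ x ∈ A.fibre p, ∀ t, Fin.snoc x t ∈ A.gfibre p ↔ t = A.hybrid p x :=
    fun x hx t => snoc_mem_gfibre_iff_of_functional hA hx t
  have hgB : ∀ x ∈ A.fibre p, ∀ t, Fin.snoc x t ∈ B.gfibre p ↔ t = B.hybrid p x :=
    fun x hx t => snoc_mem_gfibre_iff_of_functional hB (by rw [hBT, ← hAT]; exact hx) t
  have hle' := (leClause_iff hgA hgB).1 hle
  have hdom := (domClauses_iff (T := T) hgA hgB).1 ⟨hd₁, hd₂⟩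
  have hgW : ∀ x ∈ A.fibre p, ∀ t, A.hybrid p x ≤ t → t ≤ B.hybrid p x → ∀ v,
      Fin.snoc (Fin.snoc x t) v ∈ W.gfibre p ↔ v = W.hybrid p (Fin.snoc x t) :=
    fun x hx t h₁ h₂ v =>
      snoc_mem_gfibre_iff_of_functional hW (by rw [hWT]; exact (hdom x t).2 ⟨hx, h₁, h₂⟩) v
  have hgT : ∀ x ∈ A.fibre p, ∀ t, A.hybrid p x < t → t < B.hybrid p x → ∀ v,
      Fin.snoc (Fin.snoc x t) v ∈ T.gfibre p ↔ v = (T.repI p).integrand (Fin.snoc x t) :=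
    fun x hx t h₁ h₂ v => snoc_mem_gfibre_iff_of_admI hT ((hdom x t).2 ⟨hx, h₁.le, h₂.le⟩) v
  have hgT' : ∀ x ∈ T'.fibre p, ∀ t,
      Fin.snoc x t ∈ T'.gfibre p ↔ t = (T'.repI p).integrand x :=
    fun x hx t => snoc_mem_gfibre_iff_of_admI hT' hx t
  refine ⟨hle', fibre_eq_of_domClauses hgA hgB hd₁ hd₂, (contClause_iff hgA hgB hgW).1 hco,
    (derivClause_iff hgA hgB (fun x hx s h₁ h₂ => hgW x hx s h₁.le h₂.le) hgT).1 hde, ?_,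
    hWT, rfl, by rw [hBT, hAT]⟩
  have h := (nlClause_iff (T' := T') (fun x hx => hgA x (hAT ▸ hx)) (fun x hx => hgB x (hAT ▸ hx))
    (fun x hx => hgW x (hAT ▸ hx) _ le_rfl (hle' x (hAT ▸ hx)))
    (fun x hx => hgW x (hAT ▸ hx) _ (hle' x (hAT ▸ hx)) le_rfl) hgT').1 hnl
  exact fun x hx => h x (hAT.symm ▸ hx)

end SoloInformedPTerm

/-! ### The move -/

/-- From base-change equations and the (3) side conditions on the real representations to
membership in `KZOver.newtonLeibnizRel k`. [cite: KontsevichZagier2001, §1.2 rule (3)] -/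
theorem soloInformed_mem_newtonLeibnizRel_of_baseChange {k : Type*} [Field k] [Algebra k ℝ]
    {n : ℕ} {x : KZOver.IntegralRep k (n + 1)} {y : KZOver.IntegralRep k n}
    {A : KZOver.IntegralRep ℝ (n + 1)} {A' : KZOver.IntegralRep ℝ n}
    (hx : x.baseChange ℝ = A) (hy : y.baseChange ℝ = A')
    {a b : (Fin n → ℝ) → ℝ} {F : (Fin (n + 1) → ℝ) → ℝ}
    (hF : IsSemialgebraicFunOn k A.domain F) (ha : IsSemialgebraicFunOn k A'.domain a)
    (hb : IsSemialgebraicFunOn k A'.domain b) (hle : ∀ x ∈ A'.domain, a x ≤ b x)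
    (hdom : A.domain = {z | (Fin.init z : Fin n → ℝ) ∈ A'.domain ∧
      a (Fin.init z) ≤ z (Fin.last n) ∧ z (Fin.last n) ≤ b (Fin.init z)})
    (hcont : ∀ x ∈ A'.domain, ContinuousOn (fun t : ℝ => F (Fin.snoc x t)) (Icc (a x) (b x)))
    (hderiv : ∀ x ∈ A'.domain, ∀ t ∈ Ioo (a x) (b x),
      HasDerivAt (fun s : ℝ => F (Fin.snoc x s)) (A.integrand (Fin.snoc x t)) t)
    (hnl : ∀ x ∈ A'.domain, A'.integrand x = F (Fin.snoc x (b x)) - F (Fin.snoc x (a x))) :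
    KZOver.of x - KZOver.of y ∈ KZOver.newtonLeibnizRel k := by
  subst hx hy
  exact ⟨n, x, y, a, b, F, hF, ha, hb, hle, hdom, hcont, hderiv, hnl, rfl⟩

/-- **Definability of the Newton–Leibniz move (3), arbitrary representations** (conditional on
the preparation fact). [cite: KontsevichZagier2001, §1.2 rule (3)] -/
theorem soloInformed_definableRelI_of_mem_newtonLeibnizRel (hprep : semialgebraicPreparation)
    {c : KZOver.FormalRep ℝ} (hc : c ∈ KZOver.newtonLeibnizRel ℝ) :
    SoloInformedDefinableRelI c := by
  classical
  obtain ⟨n, r, r', a, b, F, hF, ha, hb, hle, hdom, hcont, hderiv, hnl, rfl⟩ := hc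
  obtain ⟨K₀, _, T₀, p₀, hA₀, hrep₀, -⟩ := soloInformed_exists_pterm_repI r
  obtain ⟨K₁, _, T₁, p₁, hA₁, hrep₁, -⟩ := soloInformed_exists_pterm_repI r'
  obtain ⟨K₂, _, W₀, p₂, hWf₀, hWfib₀, hWg₀, -, -⟩ :=
    soloInformed_exists_pterm_of_funOn r.isSemialgebraic_domain hF F
  obtain ⟨K₃, _, A₀, p₃, hAf₀, hAfib₀, hAg₀, -, -⟩ :=
    soloInformed_exists_pterm_of_funOn r'.isSemialgebraic_domain ha a
  obtain ⟨K₄, _, B₀, p₄, hBf₀, hBfib₀, hBg₀, -, -⟩ :=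
    soloInformed_exists_pterm_of_funOn r'.isSemialgebraic_domain hb b
  -- common parameter space
  let θ₀ : K₀ → (((K₀ ⊕ K₁) ⊕ K₂) ⊕ K₃) ⊕ K₄ := fun i => Sum.inl (Sum.inl (Sum.inl (Sum.inl i)))
  let θ₁ : K₁ → (((K₀ ⊕ K₁) ⊕ K₂) ⊕ K₃) ⊕ K₄ := fun i => Sum.inl (Sum.inl (Sum.inl (Sum.inr i)))
  let θ₂ : K₂ → (((K₀ ⊕ K₁) ⊕ K₂) ⊕ K₃) ⊕ K₄ := fun i => Sum.inl (Sum.inl (Sum.inr i))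
  let θ₃ : K₃ → (((K₀ ⊕ K₁) ⊕ K₂) ⊕ K₃) ⊕ K₄ := fun i => Sum.inl (Sum.inr i)
  let θ₄ : K₄ → (((K₀ ⊕ K₁) ⊕ K₂) ⊕ K₃) ⊕ K₄ := Sum.inr
  let T := T₀.pullback θ₀
  let T' := T₁.pullback θ₁
  let W := W₀.pullback θ₂
  let A := A₀.pullback θ₃
  let B := B₀.pullback θ₄
  let q : (((K₀ ⊕ K₁) ⊕ K₂) ⊕ K₃) ⊕ K₄ → ℝ :=
    Sum.elim (Sum.elim (Sum.elim (Sum.elim p₀ p₁) p₂) p₃) p₄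
  have hq₀ : q ∘ θ₀ = p₀ := rfl
  have hq₁ : q ∘ θ₁ = p₁ := rfl
  have hq₂ : q ∘ θ₂ = p₂ := rfl
  have hq₃ : q ∘ θ₃ = p₃ := rfl
  have hq₄ : q ∘ θ₄ = p₄ := Sum.elim_comp_inr _ _
  have hTrep : ∀ p, T.repI p = T₀.repI (p ∘ θ₀) := fun p => SoloInformedPTerm.repI_pullback _ _ _
  have hT'rep : ∀ p, T'.repI p = T₁.repI (p ∘ θ₁) := fun p =>
    SoloInformedPTerm.repI_pullback _ _ _
  have hTadm : ∀ p, T.SoloInformedAdmI p ↔ T₀.SoloInformedAdmI (p ∘ θ₀) := fun p =>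
    SoloInformedPTerm.admI_pullback_iff _ _ _
  have hT'adm : ∀ p, T'.SoloInformedAdmI p ↔ T₁.SoloInformedAdmI (p ∘ θ₁) := fun p =>
    SoloInformedPTerm.admI_pullback_iff _ _ _
  have hWfun : ∀ p, W.SoloInformedFunctional p ↔ W₀.SoloInformedFunctional (p ∘ θ₂) := fun p =>
    SoloInformedPTerm.functional_pullback_iff (T := W₀) (θ := θ₂) (p' := p)
  have hAfun : ∀ p, A.SoloInformedFunctional p ↔ A₀.SoloInformedFunctional (p ∘ θ₃) := fun p =>
    SoloInformedPTerm.functional_pullback_iff (T := A₀) (θ := θ₃) (p' := p)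
  have hBfun : ∀ p, B.SoloInformedFunctional p ↔ B₀.SoloInformedFunctional (p ∘ θ₄) := fun p =>
    SoloInformedPTerm.functional_pullback_iff (T := B₀) (θ := θ₄) (p' := p)
  have hWfib : ∀ p, W.fibre p = W₀.fibre (p ∘ θ₂) := fun p =>
    SoloInformedPTerm.fibre_pullback (T := W₀) (θ := θ₂) (p' := p)
  have hAfib : ∀ p, A.fibre p = A₀.fibre (p ∘ θ₃) := fun p =>
    SoloInformedPTerm.fibre_pullback (T := A₀) (θ := θ₃) (p' := p)
  have hBfib : ∀ p, B.fibre p = B₀.fibre (p ∘ θ₄) := fun p =>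
    SoloInformedPTerm.fibre_pullback (T := B₀) (θ := θ₄) (p' := p)
  have hWgf : ∀ p, W.gfibre p = W₀.gfibre (p ∘ θ₂) := fun p =>
    SoloInformedPTerm.gfibre_pullback (T := W₀) (θ := θ₂) (p' := p)
  have hAgf : ∀ p, A.gfibre p = A₀.gfibre (p ∘ θ₃) := fun p =>
    SoloInformedPTerm.gfibre_pullback (T := A₀) (θ := θ₃) (p' := p)
  have hBgf : ∀ p, B.gfibre p = B₀.gfibre (p ∘ θ₄) := fun p =>
    SoloInformedPTerm.gfibre_pullback (T := B₀) (θ := θ₄) (p' := p)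
  -- the good set
  let V : Set ((((K₀ ⊕ K₁) ⊕ K₂) ⊕ K₃) ⊕ K₄ → ℝ) := {p | T.SoloInformedAdmI p ∧
    T'.SoloInformedAdmI p ∧ W.SoloInformedFunctional p ∧ A.SoloInformedFunctional p ∧
    B.SoloInformedFunctional p ∧ W.fibre p = T.fibre p ∧ A.fibre p = T'.fibre p ∧
    B.fibre p = T'.fibre p ∧ SoloInformedPTerm.SoloInformedLeClause A B p ∧
    SoloInformedPTerm.SoloInformedDomClause₁ T A B p ∧
    SoloInformedPTerm.SoloInformedDomClause₂ T A B p ∧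
    SoloInformedPTerm.SoloInformedNLClause T' W A B p ∧
    SoloInformedPTerm.SoloInformedContClause W A B p ∧
    SoloInformedPTerm.SoloInformedDerivClause T W A B p}
  have hV : IsSemialgebraic ℚ V :=
    soloInformed_isSemialgebraic_setOf_and (T.isSemialgebraic_setOf_admI hprep)
    (soloInformed_isSemialgebraic_setOf_and (T'.isSemialgebraic_setOf_admI hprep)
    (soloInformed_isSemialgebraic_setOf_and W.isSemialgebraic_setOf_functional
    (soloInformed_isSemialgebraic_setOf_and A.isSemialgebraic_setOf_functional
    (soloInformed_isSemialgebraic_setOf_and B.isSemialgebraic_setOf_functional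
    (soloInformed_isSemialgebraic_setOf_and (SoloInformedPTerm.isSemialgebraic_setOf_fibre_eq _ _)
    (soloInformed_isSemialgebraic_setOf_and (SoloInformedPTerm.isSemialgebraic_setOf_fibre_eq _ _)
    (soloInformed_isSemialgebraic_setOf_and (SoloInformedPTerm.isSemialgebraic_setOf_fibre_eq _ _)
    (soloInformed_isSemialgebraic_setOf_and (SoloInformedPTerm.isSemialgebraic_setOf_leClause _ _)
    (soloInformed_isSemialgebraic_setOf_and
      (SoloInformedPTerm.isSemialgebraic_setOf_domClause₁ _ _ _)
    (soloInformed_isSemialgebraic_setOf_and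
      (SoloInformedPTerm.isSemialgebraic_setOf_domClause₂ _ _ _)
    (soloInformed_isSemialgebraic_setOf_and
      (SoloInformedPTerm.isSemialgebraic_setOf_nlClause _ _ _ _)
    (soloInformed_isSemialgebraic_setOf_and
      (SoloInformedPTerm.isSemialgebraic_setOf_contClause _ _ _)
    (SoloInformedPTerm.isSemialgebraic_setOf_derivClause _ _ _ _)))))))))))))
  refine ⟨(((K₀ ⊕ K₁) ⊕ K₂) ⊕ K₃) ⊕ K₄, inferInstance, SoloInformedPCombo.twoTerm T T', q, V, hV,
    ?_, ?_, ?_, ?_⟩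
  · -- the original parameter is good
    have hT : T.SoloInformedAdmI q := (hTadm q).2 (hq₀ ▸ hA₀)
    have hT' : T'.SoloInformedAdmI q := (hT'adm q).2 (hq₁ ▸ hA₁)
    have hW : W.SoloInformedFunctional q := (hWfun q).2 (hq₂ ▸ hWf₀)
    have hA : A.SoloInformedFunctional q := (hAfun q).2 (hq₃ ▸ hAf₀)
    have hB : B.SoloInformedFunctional q := (hBfun q).2 (hq₄ ▸ hBf₀)
    have hTq : T.repI q = r := by rw [hTrep, hq₀, hrep₀]
    have hT'q : T'.repI q = r' := by rw [hT'rep, hq₁, hrep₁]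
    have hfT : T.fibre q = r.domain := by rw [← SoloInformedPTerm.repI_domain hT, hTq]
    have hfT' : T'.fibre q = r'.domain := by rw [← SoloInformedPTerm.repI_domain hT', hT'q]
    have hfW : W.fibre q = r.domain := by rw [hWfib, hq₂, hWfib₀]
    have hfA : A.fibre q = r'.domain := by rw [hAfib, hq₃, hAfib₀]
    have hfB : B.fibre q = r'.domain := by rw [hBfib, hq₄, hBfib₀]
    have hmem : ∀ x ∈ r'.domain, ∀ t, a x ≤ t → t ≤ b x → Fin.snoc x t ∈ r.domain :=
      fun x hx t h₁ h₂ => by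
        rw [hdom]
        simp only [mem_setOf_eq, Fin.init_snoc, Fin.snoc_last]
        exact ⟨hx, h₁, h₂⟩
    have hgA : ∀ x ∈ A.fibre q, ∀ t, Fin.snoc x t ∈ A.gfibre q ↔ t = a x := fun x hx t => by
      rw [hAgf, hq₃]
      exact hAg₀ x (hfA ▸ hx) t
    have hgB : ∀ x ∈ A.fibre q, ∀ t, Fin.snoc x t ∈ B.gfibre q ↔ t = b x := fun x hx t => by
      rw [hBgf, hq₄]
      exact hBg₀ x (hfA ▸ hx) t
    have hgW : ∀ x ∈ A.fibre q, ∀ t, a x ≤ t → t ≤ b x → ∀ v,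
        Fin.snoc (Fin.snoc x t) v ∈ W.gfibre q ↔ v = F (Fin.snoc x t) :=
      fun x hx t h₁ h₂ v => by
        rw [hWgf, hq₂]
        exact hWg₀ _ (hmem x (hfA ▸ hx) t h₁ h₂) v
    have hgT : ∀ x ∈ A.fibre q, ∀ t, a x < t → t < b x → ∀ v,
        Fin.snoc (Fin.snoc x t) v ∈ T.gfibre q ↔ v = r.integrand (Fin.snoc x t) :=
      fun x hx t h₁ h₂ v => by
        rw [SoloInformedPTerm.snoc_mem_gfibre_iff_of_admI hT
          (hfT.symm ▸ hmem x (hfA ▸ hx) t h₁.le h₂.le), hTq]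
    have hgT' : ∀ x ∈ T'.fibre q, ∀ t, Fin.snoc x t ∈ T'.gfibre q ↔ t = r'.integrand x :=
      fun x hx t => by rw [SoloInformedPTerm.snoc_mem_gfibre_iff_of_admI hT' hx, hT'q]
    have hAT : A.fibre q = T'.fibre q := hfA.trans hfT'.symm
    obtain ⟨hd₁, hd₂⟩ := (SoloInformedPTerm.domClauses_iff (T := T) hgA hgB).2 fun x t => by
      rw [hfT, hfA, hdom]
      simp only [mem_setOf_eq, Fin.init_snoc, Fin.snoc_last]
    refine ⟨hT, hT', hW, hA, hB, hfW.trans hfT.symm, hAT, hfB.trans hfT'.symm,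
      (SoloInformedPTerm.leClause_iff hgA hgB).2 fun x hx => hle x (hfA ▸ hx), hd₁, hd₂,
      (SoloInformedPTerm.nlClause_iff (T' := T') (fun x hx => hgA x (hAT.symm ▸ hx))
        (fun x hx => hgB x (hAT.symm ▸ hx))
        (fun x hx => hgW x (hAT.symm ▸ hx) _ le_rfl (hle x (hfT' ▸ hx)))
        (fun x hx => hgW x (hAT.symm ▸ hx) _ (hle x (hfT' ▸ hx)) le_rfl) hgT').2
        fun x hx => hnl x (hfT' ▸ hx),
      (SoloInformedPTerm.contClause_iff hgA hgB hgW).2 fun x hx => hcont x (hfA ▸ hx),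
      (SoloInformedPTerm.derivClause_iff hgA hgB (fun x hx s h₁ h₂ => hgW x hx s h₁.le h₂.le)
        hgT).2 fun x hx => hderiv x (hfA ▸ hx)⟩
  · -- it denotes `c`
    rw [SoloInformedPCombo.comboI_twoTerm, hTrep, hT'rep, hq₀, hq₁, hrep₀, hrep₁]
  · -- every good parameter denotes a (3) move over `ℝ`
    rintro p ⟨hT, hT', hW, hA, hB, hWT, hAT, hBT, hle', hd₁, hd₂, hnl', hco, hde⟩
    obtain ⟨h₁, h₂, h₃, h₄, h₅, hWd, hAd, hBd⟩ :=
      SoloInformedPTerm.nl_sideI hT hT' hW hA hB hWT hAT hBT hle' hd₁ hd₂ hnl' hco hde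
    refine ⟨SoloInformedPCombo.admI_twoTerm hT hT', ?_⟩
    rw [SoloInformedPCombo.comboI_twoTerm]
    exact KZOver.newtonLeibnizRel_subset_relations
      (soloInformed_mem_newtonLeibnizRel_of_baseChange (soloInformed_baseChange_real _)
        (soloInformed_baseChange_real _) (hWd ▸ SoloInformedPTerm.isSemialgebraicFunOn_hybrid hW)
        (hAd ▸ SoloInformedPTerm.isSemialgebraicFunOn_hybrid hA)
        (hBd ▸ SoloInformedPTerm.isSemialgebraicFunOn_hybrid hB) h₁ h₂ h₃ h₄ h₅)
  · -- rational lift at parameters with rational fibres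
    rintro p ⟨hT, hT', hW, hA, hB, hWT, hAT, hBT, hle', hd₁, hd₂, hnl', hco, hde⟩ hRF
    obtain ⟨h₁, h₂, h₃, h₄, h₅, hWd, hAd, hBd⟩ :=
      SoloInformedPTerm.nl_sideI hT hT' hW hA hB hWT hAT hBT hle' hd₁ hd₂ hnl' hco hde
    obtain ⟨hS₀, hG₀⟩ := soloInformedRatFibres.fibre hRF T
    obtain ⟨hS₁, hG₁⟩ := soloInformedRatFibres.fibre hRF T'
    obtain ⟨hS₂, hG₂⟩ := soloInformedRatFibres.fibre hRF W
    obtain ⟨hS₃, hG₃⟩ := soloInformedRatFibres.fibre hRF A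
    obtain ⟨hS₄, hG₄⟩ := soloInformedRatFibres.fibre hRF B
    refine SoloInformedPCombo.ratLiftI_twoTerm (SoloInformedPTerm.ratRepI hS₀ hG₀ hT)
      (SoloInformedPTerm.ratRepI hS₁ hG₁ hT') (SoloInformedPTerm.baseChange_ratRepI _ _ _)
      (SoloInformedPTerm.baseChange_ratRepI _ _ _) ?_
    exact KZOver.newtonLeibnizRel_subset_relations
      (soloInformed_mem_newtonLeibnizRel_of_baseChange
        (SoloInformedPTerm.baseChange_ratRepI _ _ _) (SoloInformedPTerm.baseChange_ratRepI _ _ _)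
        (hWd ▸ SoloInformedPTerm.isSemialgebraicFunOn_hybrid_of hS₂ hG₂ hW)
        (hAd ▸ SoloInformedPTerm.isSemialgebraicFunOn_hybrid_of hS₃ hG₃ hA)
        (hBd ▸ SoloInformedPTerm.isSemialgebraicFunOn_hybrid_of hS₄ hG₄ hB) h₁ h₂ h₃ h₄ h₅)

/-- **The (3) hypothesis of THEOREM R / T for arbitrary chains, discharged** (conditional on the
preparation fact). [cite: KontsevichZagier2001, §1.2] -/
theorem soloInformed_definableRelI_newtonLeibnizRel (hprep : semialgebraicPreparation) :
    ∀ c ∈ KZOver.newtonLeibnizRel ℝ, SoloInformedDefinableRelI c :=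
  fun _ hc => soloInformed_definableRelI_of_mem_newtonLeibnizRel hprep hc

end Summit.KontsevichZagierPeriods.KontsevichZagierPeriods.Theorems
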